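import Summits.ResolutionOfSingularities.ResolutionOfSingularities.Theorems.PurelyInseparableDim4PureLeafKForms
import Summits.ResolutionOfSingularities.ResolutionOfSingularities.Theorems.PurelyInseparableDim4PureLeafFpMoves
import HarnessLib
import HarnessLib.Audit.Tags

/-!
# Purely inseparable fourfolds — BLOCK CHARTS, ORDERS and TERMINAL POSITIONS of the general form over ANY field of characteristic `p`
# (cell res-dim4-pi; D3d kit G_K: kit G `…PureLeafFpMoves` with a finite root set `R ⊂ K`)
# [OURS · counted 0 · bookkeeping identities of OUR frame, not about resolution]

Width seat `res-dim4-p-10` (g3).  For the general form `T(R,k)·(N(R,μ) − C γ₀)` of kit F_K (`…PureLeafKForms`):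

* §1 `ordAlong_generalForm_C_zero` (product regime: `ord_{(x_S)} = Σ_{i∈S} (p·k i 0 + μ i 0)`), `le_ordAlong_singleton_generalForm`;
* §2 the BLOCK CHART of a centre of pure monomial variables: `splitForm_block_eq`, `chartTransform_block_splitForm`,
  **`step_block_generalForm`**;
* §3 TERMINAL positions of the bracket regime: `coeff_zero_splitForm`, `splitForm_eq_prod_linearPow`, `coeff_single_generalForm`,
  **`ordAlong_generalForm_le_one`** (no `x_j^p` in `T` and an active variable ⇒ order `≤ 1` along every coordinate centre).

Nothing here proves resolution of singularities in dimension ≥ 4 / characteristic `p`; counted 0; AI work, weaker than expert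
review. bears_on: LADDER-RESOLUTION:D157-DOOR2 (res-dim4-pi · D3d kit G_K). Supports stmt-ResolutionOfSingularities-16155 (helper).
-/

set_option linter.dupNamespace false

open MvPolynomial Finset

open scoped BigOperators

noncomputable section

namespace Summit.ResolutionOfSingularities.ResolutionOfSingularities.Theorems.PIDim4

namespace PureLeafK

open Literature.AlgebraicGeometry.Resolution
open Literature.AlgebraicGeometry.Resolution.Hauser2010
open CentreBlowup PthPowerFactor PureLeafNF

variable {σ : Type*} [Fintype σ] [DecidableEq σ] {K : Type*} [Field K] [DecidableEq K] (p : ℕ) [Fact p.Prime] [CharP K p]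

/-! ## 1. Orders -/

omit [DecidableEq σ] [Fact p.Prime] [CharP K p] in
/-- **Order of a product state along a coordinate centre**: `Σ_{i∈S} (p·k i 0 + μ i 0)` (supports in `R`). [folklore] -/
theorem ordAlong_generalForm_C_zero (R : Finset K) (k μ : σ → K → ℕ) (hSk : ∀ i c, c ∉ R → k i c = 0)
    (hSμ : ∀ i c, c ∉ R → μ i c = 0) (S : Finset σ) :
    ordAlong S ((∏ i, ∏ c ∈ R, (X i + C c) ^ (p * k i c) : MvPolynomial σ K) * ((∏ i, ∏ c ∈ R, (X i + C c) ^ μ i c) - C 0)) =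
      ((∑ i ∈ S, (p * k i 0 + μ i 0) : ℕ) : ℕ∞) := by
  rw [generalForm_C_zero, ordAlong_splitForm R _ (fun i c hc => by rw [hSk i c hc, hSμ i c hc, mul_zero])]
  rfl

omit [Fact p.Prime] [CharP K p] in
/-- **A singleton centre `{x_j}` with `1 ≤ k j 0` is permissible at every general form.** [folklore] -/
theorem le_ordAlong_singleton_generalForm (R : Finset K) (k μ : σ → K → ℕ) (hSk : ∀ i c, c ∉ R → k i c = 0) (γ₀ : K)
    {j : σ} (hj : 1 ≤ k j 0) :
    (p : ℕ∞) ≤ ordAlong {j} ((∏ i, ∏ c ∈ R, (X i + C c) ^ (p * k i c) : MvPolynomial σ K) *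
        ((∏ i, ∏ c ∈ R, (X i + C c) ^ μ i c) - C γ₀)) := by
  rw [powPart_eq_X_pow_mul p R k hSk hj, mul_assoc]
  refine le_trans ?_ (ordAlong_add_ordAlong_le_mul {j} _ _)
  rw [ordAlong_X_pow, if_pos (Finset.mem_singleton_self j)]
  exact le_self_add

/-! ## 2. The block chart of pure monomial variables -/

omit [Fact p.Prime] [CharP K p] in
/-- **Block decomposition** (support in `R`; variables of `S` pure): `N(R,m) = monomial (Σ_{i∈S} (m i 0)·eᵢ) 1 · ∏_{i∉S} ∏_{c∈R} …`.
[folklore] -/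
theorem splitForm_block_eq (R : Finset K) (m : σ → K → ℕ) (hS : ∀ i c, c ∉ R → m i c = 0) (S : Finset σ)
    (hpure : ∀ i ∈ S, ∀ c, c ≠ 0 → m i c = 0) :
    (∏ i, ∏ c ∈ R, (X i + C c) ^ m i c : MvPolynomial σ K) =
      monomial (∑ i ∈ S, Finsupp.single i (m i 0)) 1 * ∏ i ∈ Sᶜ, ∏ c ∈ R, (X i + C c) ^ m i c := by
  rw [← Finset.prod_mul_prod_compl S, ← PureLeafNF.prod_X_pow_eq_monomial]
  congr 1
  refine Finset.prod_congr rfl fun i hi => ?_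
  by_cases h0 : (0 : K) ∈ R
  · rw [← Finset.mul_prod_erase R _ h0, C_0, add_zero, Finset.prod_eq_one fun c hc => ?_, mul_one]
    rw [hpure i hi c (Finset.ne_of_mem_erase hc), pow_zero]
  · rw [hS i 0 h0, pow_zero]
    exact Finset.prod_eq_one fun c hc => by
      rw [hpure i hi c (fun h => h0 (h ▸ hc)), pow_zero]

omit [Fact p.Prime] [CharP K p] in
/-- **The block chart**: centre `S` of pure variables, chart `j ∈ S`: the exponent of `x_j` becomes `Σ_{i∈S} m i 0 − p`. [folklore] -/
theorem chartTransform_block_splitForm (R : Finset K) (m : σ → K → ℕ) (hS : ∀ i c, c ∉ R → m i c = 0) (S : Finset σ)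
    {j : σ} (hj : j ∈ S) (hpure : ∀ i ∈ S, ∀ c, c ≠ 0 → m i c = 0) (h0 : (0 : K) ∈ R) :
    chartTransform p S j (∏ i, ∏ c ∈ R, (X i + C c) ^ m i c : MvPolynomial σ K) =
      ∏ i, ∏ c ∈ R, (X i + C c) ^ (if i = j ∧ c = 0 then (∑ i ∈ S, m i 0) - p else m i c) := by
  have hpure' : ∀ i ∈ S, ∀ c, c ≠ 0 → (if i = j ∧ c = 0 then (∑ i ∈ S, m i 0) - p else m i c) = 0 :=
    fun i hi c hc => by rw [if_neg (fun h => hc h.2)]; exact hpure i hi c hc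
  have hS' : ∀ i c, c ∉ R → (if i = j ∧ c = 0 then (∑ i ∈ S, m i 0) - p else m i c) = 0 :=
    fun i c hc => by rw [if_neg (fun h : i = j ∧ c = 0 => hc (by rw [h.2]; exact h0))]; exact hS i c hc
  rw [splitForm_block_eq R m hS S hpure, splitForm_block_eq R _ hS' S hpure',
    MohAlong.chartTransform_mul_offS hj p _ _ (fun u hu i hi =>
      apply_eq_zero_of_mem_support_prod_linearFactors R Sᶜ (fun c : K => c) m hu (fun h => (Finset.mem_compl.mp h) hi)),
    chartTransform_monomial]
  have hcof : (∏ i ∈ Sᶜ, ∏ c ∈ R, (X i + C c) ^ m i c : MvPolynomial σ K) =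
      ∏ i ∈ Sᶜ, ∏ c ∈ R, (X i + C c) ^ (if i = j ∧ c = 0 then (∑ i ∈ S, m i 0) - p else m i c) :=
    Finset.prod_congr rfl fun i hi => Finset.prod_congr rfl fun c _ => by
      have hij : i ≠ j := fun h => (Finset.mem_compl.mp hi) (h ▸ hj)
      rw [if_neg (fun h => hij h.1)]
  have hexp : chartExponent p S j (∑ i ∈ S, Finsupp.single i (m i 0)) =
      ∑ i ∈ S, Finsupp.single i (if i = j ∧ (0 : K) = 0 then (∑ i ∈ S, m i 0) - p else m i 0) := by
    rw [chartExponent_eq_iff]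
    refine ⟨?_, fun i hi => ?_⟩
    · rw [sum_single_apply, if_pos hj, if_pos ⟨rfl, rfl⟩]
      unfold degIn
      congr 1
      exact Finset.sum_congr rfl fun i hi => by rw [sum_single_apply, if_pos hi]
    · rw [sum_single_apply, sum_single_apply]
      by_cases hiS : i ∈ S
      · rw [if_pos hiS, if_pos hiS, if_neg (fun h => hi h.1)]
      · rw [if_neg hiS, if_neg hiS]
  rw [hcof, hexp]

/-- **THE BLOCK MOVE over `K`** on a product state `T(R,k)·(N(R,μ) − C 0)`: centre `S` of pure variables with `k ≡ 0` on `S`, chart `j ∈ S`,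
`Σ_S μ i 0 − p < p`, ANY `K`-rational reply `b`. [OURS · counted 0] [folklore] -/
theorem step_block_generalForm (s : CState σ K) (R : Finset K) (k μ : σ → K → ℕ)
    (hF : s.F = (∏ i, ∏ c ∈ R, (X i + C c) ^ (p * k i c) : MvPolynomial σ K) * ((∏ i, ∏ c ∈ R, (X i + C c) ^ μ i c) - C 0))
    (hSk : ∀ i c, c ∉ R → k i c = 0) (hSμ : ∀ i c, c ∉ R → μ i c = 0)
    (hμ : ∀ i c, μ i c < p) (h1 : ∀ i c, μ i c ≠ 0 → ∀ c', c' ≠ c → μ i c' = 0)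
    (S : Finset σ) {j : σ} (hj : j ∈ S) (hn : ∀ i ∈ S, ∀ c, k i c = 0) (hμS : ∀ i ∈ S, ∀ c, c ≠ 0 → μ i c = 0)
    (hj0 : μ j 0 ≠ 0) (hlt : (∑ i ∈ S, μ i 0) - p < p) (b : σ → K) :
    (step p S j b s).F =
      (∏ i, ∏ c ∈ Finset.univ.biUnion (fun i => R.map (addRightEmbedding (b i))), (X i + C c) ^ (p * k i (c - b i)) :
          MvPolynomial σ K) *
        ((∏ i, ∏ c ∈ Finset.univ.biUnion (fun i => R.map (addRightEmbedding (b i))),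
            (X i + C c) ^ (if i = j ∧ c - b i = 0 then (∑ i ∈ S, μ i 0) - p else μ i (c - b i))) -
          C (∏ i, ∏ c ∈ Finset.univ.biUnion (fun i => R.map (addRightEmbedding (b i))),
            c ^ (if i = j ∧ c - b i = 0 then (∑ i ∈ S, μ i 0) - p else μ i (c - b i)))) := by
  have h0 : (0 : K) ∈ R := by by_contra h; exact hj0 (hSμ j 0 h)
  have hpure : ∀ i ∈ S, ∀ c, c ≠ 0 → p * k i c + μ i c = 0 := fun i hi c hc => by
    rw [hn i hi c, hμS i hi c hc, mul_zero]
  have hSm : ∀ i c, c ∉ R → p * k i c + μ i c = 0 := fun i c hc => by rw [hSk i c hc, hSμ i c hc, mul_zero]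
  have hsum : (∑ i ∈ S, (p * k i 0 + μ i 0)) = ∑ i ∈ S, μ i 0 :=
    Finset.sum_congr rfl fun i hi => by rw [hn i hi 0, mul_zero, zero_add]
  have hSμ' : ∀ i c, c ∉ R → (if i = j ∧ c = 0 then (∑ i ∈ S, μ i 0) - p else μ i c) = 0 :=
    fun i c hc => by rw [if_neg (fun h : i = j ∧ c = 0 => hc (by rw [h.2]; exact h0))]; exact hSμ i c hc
  have hchart : chartTransform p S j s.F =
      (∏ i, ∏ c ∈ R, (X i + C c) ^ (p * k i c) : MvPolynomial σ K) *
        ((∏ i, ∏ c ∈ R, (X i + C c) ^ (if i = j ∧ c = 0 then (∑ i ∈ S, μ i 0) - p else μ i c)) - C 0) := by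
    rw [hF, generalForm_C_zero, chartTransform_block_splitForm p R _ hSm S hj hpure h0, generalForm_C_zero, hsum]
    refine Finset.prod_congr rfl fun i _ => Finset.prod_congr rfl fun c _ => ?_
    by_cases h : i = j ∧ c = 0
    · rw [if_pos h, if_pos h, h.1, h.2, hn j hj 0, mul_zero, zero_add]
    · rw [if_neg h, if_neg h]
  have hμ' : ∀ i c, (if i = j ∧ c = 0 then (∑ i ∈ S, μ i 0) - p else μ i c) < p := fun i c => by
    split_ifs
    · exact hlt
    · exact hμ i c
  have h1' : ∀ i c, (if i = j ∧ c = 0 then (∑ i ∈ S, μ i 0) - p else μ i c) ≠ 0 →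
      ∀ c', c' ≠ c → (if i = j ∧ c' = 0 then (∑ i ∈ S, μ i 0) - p else μ i c') = 0 := fun i c hc c' hc' => by
    by_cases hij : i = j
    · subst hij
      by_cases hc0 : c = 0
      · rw [if_neg (fun h => hc' (h.2.trans hc0.symm))]
        exact hμS i hj c' (fun h => hc' (h.trans hc0.symm))
      · rw [if_neg (fun h => hc0 h.2)] at hc
        exact absurd (hμS i hj c hc0) hc
    · rw [if_neg (fun h => hij h.1)] at hc ⊢
      exact h1 i c hc c' hc'
  have htr := translate_generalForm p b R k (fun i c => if i = j ∧ c = 0 then (∑ i ∈ S, μ i 0) - p else μ i c) hSk hSμ' 0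
  have hdel := deletePthPowers_generalForm p (Finset.univ.biUnion (fun i => R.map (addRightEmbedding (b i))))
    (fun i c => k i (c - b i)) (fun i c => if i = j ∧ c - b i = 0 then (∑ i ∈ S, μ i 0) - p else μ i (c - b i)) 0
    (support_shift R _ hSμ' b) (small_shift hμ' b) (singleRoot_shift h1' b)
  change deletePthPowers p (PointBlowup.translate b (chartTransform p S j s.F)) = _
  rw [hchart, htr]
  exact hdel

/-! ## 3. Terminal positions of the bracket regime -/

omit [DecidableEq σ] [DecidableEq K] [Fact p.Prime] [CharP K p] in
/-- The constant coefficient of a split form: `N(R,m)(0) = ∏ᵢ ∏_{c∈R} c^{m i c}`. [folklore] -/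
theorem coeff_zero_splitForm (R : Finset K) (m : σ → K → ℕ) :
    coeff 0 (∏ i, ∏ c ∈ R, (X i + C c) ^ m i c : MvPolynomial σ K) = ∏ i, ∏ c ∈ R, c ^ m i c := by
  rw [← constantCoeff_eq, map_prod]
  refine Finset.prod_congr rfl fun i _ => ?_
  rw [map_prod]
  refine Finset.prod_congr rfl fun c _ => ?_
  rw [map_pow, map_add, constantCoeff_X, constantCoeff_C, zero_add]

omit [DecidableEq σ] [Fact p.Prime] [CharP K p] in
/-- A single-rooted array supported in `R` with one linear factor per variable: `N(R,μ) = ∏ᵢ (Xᵢ + C (r i))^{μ i (r i)}`. [folklore] -/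
theorem splitForm_eq_prod_linearPow (R : Finset K) (μ : σ → K → ℕ) (hS : ∀ i c, c ∉ R → μ i c = 0) (r : σ → K)
    (hr : ∀ i c, μ i c ≠ 0 → r i = c) :
    (∏ i, ∏ c ∈ R, (X i + C c) ^ μ i c : MvPolynomial σ K) = ∏ i, (X i + C (r i)) ^ μ i (r i) := by
  refine Finset.prod_congr rfl fun i _ => ?_
  by_cases hex : ∃ c, μ i c ≠ 0
  · obtain ⟨c₀, hc₀⟩ := hex
    have hr₀ : r i = c₀ := hr i c₀ hc₀
    have hc₀R : c₀ ∈ R := by by_contra h; exact hc₀ (hS i c₀ h)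
    rw [← Finset.mul_prod_erase R _ hc₀R, Finset.prod_eq_one fun c hc => ?_, mul_one, hr₀]
    have hne := Finset.ne_of_mem_erase hc
    by_cases h0 : μ i c = 0
    · rw [h0, pow_zero]
    · exact absurd ((hr i c h0).symm.trans hr₀) hne
  · push Not at hex
    rw [hex (r i), pow_zero]
    exact Finset.prod_eq_one fun c _ => by rw [hex c, pow_zero]

omit [DecidableEq K] in
/-- **The linear coefficient `xᵢ` of the general form** (all `k j 0 = 0`): `T(0) · ∏_k C(μ_k, δᵢₖ)·r_k^{μ_k − δᵢₖ}`. [folklore] -/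
theorem coeff_single_generalForm (R : Finset K) (k μ : σ → K → ℕ) (γ₀ : K) (hSμ : ∀ i c, c ∉ R → μ i c = 0)
    (r : σ → K) (hr : ∀ i c, μ i c ≠ 0 → r i = c) (i : σ) :
    coeff (Finsupp.single i 1) ((∏ t, ∏ c ∈ R, (X t + C c) ^ (p * k t c) : MvPolynomial σ K) *
        ((∏ t, ∏ c ∈ R, (X t + C c) ^ μ t c) - C γ₀)) =
      (∏ t, ∏ c ∈ R, c ^ (p * k t c)) *
        ∏ t, (((μ t (r t)).choose (Finsupp.single i 1 t) : K) * r t ^ (μ t (r t) - Finsupp.single i 1 t)) := by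
  classical
  rw [coeff_single_one_mul, coeff_zero_splitForm, coeff_sub, coeff_sub, coeff_C,
    if_neg (Finsupp.single_ne_zero.mpr one_ne_zero).symm, sub_zero, coeff_zero_splitForm, coeff_C, if_pos rfl,
    splitForm_eq_prod_linearPow R μ hSμ r hr, WeightedBlowup.coeff_prod_X_add_C_pow]
  have hE : coeff (Finsupp.single i 1) (∏ t, ∏ c ∈ R, (X t + C c) ^ (p * k t c) : MvPolynomial σ K) = 0 := by
    rw [powPart_eq_expand p R k]
    exact coeff_expand_of_not_dvd _ (fun h => by
      have := h; rw [Finsupp.single_eq_same] at this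
      exact Nat.Prime.one_lt (Fact.out : p.Prime) |>.ne' (Nat.dvd_one.mp this))
  rw [hE, zero_mul, add_zero]

omit [DecidableEq K] in
/-- **THE BRACKET REGIME WITHOUT AN `x_j^p` IS TERMINAL over `K`**: active roots non-zero, some variable active, `μ < p` single-rooted,
`k j 0 = 0` for all `j` ⇒ order `≤ 1` along every coordinate centre. [folklore] -/
theorem ordAlong_generalForm_le_one (R : Finset K) (k μ : σ → K → ℕ) (γ₀ : K)
    (hSμ : ∀ i c, c ∉ R → μ i c = 0) (hμ : ∀ i c, μ i c < p)
    (h1 : ∀ i c, μ i c ≠ 0 → ∀ c', c' ≠ c → μ i c' = 0) (hact : ∀ i c, μ i c ≠ 0 → c ≠ 0)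
    (hn0 : ∀ j, k j 0 = 0) {i₀ : σ} {c₀ : K} (hi₀ : μ i₀ c₀ ≠ 0) (S : Finset σ) :
    ordAlong S ((∏ t, ∏ c ∈ R, (X t + C c) ^ (p * k t c) : MvPolynomial σ K) *
        ((∏ t, ∏ c ∈ R, (X t + C c) ^ μ t c) - C γ₀)) ≤ 1 := by
  classical
  let r : σ → K := fun i => if h : ∃ c, μ i c ≠ 0 then h.choose else 0
  have hr : ∀ i c, μ i c ≠ 0 → r i = c := fun i c hc => by
    have hex : ∃ c, μ i c ≠ 0 := ⟨c, hc⟩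
    have hri : r i = hex.choose := dif_pos hex
    rw [hri]
    by_contra hne
    exact hex.choose_spec (h1 i c hc _ hne)
  have hcoeff := coeff_single_generalForm p R k μ γ₀ hSμ r hr i₀
  have hne : coeff (Finsupp.single i₀ 1) ((∏ t, ∏ c ∈ R, (X t + C c) ^ (p * k t c) : MvPolynomial σ K) *
      ((∏ t, ∏ c ∈ R, (X t + C c) ^ μ t c) - C γ₀)) ≠ 0 := by
    rw [hcoeff]
    refine mul_ne_zero ?_ ?_
    · refine Finset.prod_ne_zero_iff.mpr fun t _ => Finset.prod_ne_zero_iff.mpr fun c hc => ?_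
      by_cases hc0 : c = 0
      · rw [hc0, hn0 t, mul_zero, pow_zero]; exact one_ne_zero
      · exact pow_ne_zero _ hc0
    · refine Finset.prod_ne_zero_iff.mpr fun t _ => ?_
      by_cases ht : t = i₀
      · subst ht
        have hrt : r t = c₀ := hr t c₀ hi₀
        rw [Finsupp.single_eq_same, Nat.choose_one_right, hrt]
        refine mul_ne_zero ?_ (pow_ne_zero _ (hact t c₀ hi₀))
        rw [Ne, CharP.cast_eq_zero_iff K p]
        exact fun hdvd => absurd (Nat.le_of_dvd (Nat.pos_of_ne_zero hi₀) hdvd) (not_le.mpr (hμ t c₀))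
      · rw [Finsupp.single_eq_of_ne ht, Nat.choose_zero_right, Nat.cast_one, one_mul, Nat.sub_zero]
        by_cases h0 : μ t (r t) = 0
        · rw [h0, pow_zero]; exact one_ne_zero
        · exact pow_ne_zero _ (hact t (r t) h0)
  have hle := ordAlong_le_of_coeff_ne_zero (S := S) hne
  refine le_trans hle ?_
  rw [degIn_single]
  split_ifs <;> simp

end PureLeafK

end Summit.ResolutionOfSingularities.ResolutionOfSingularities.Theorems.PIDim4

end
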